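/-
Copyright: statement-level skeleton of a published paper (lit-balaban cell, Phase-2 proof seat p25, gen 18). No proof
claims beyond what the kernel checks below.
-/
import Literature.MathematicalPhysics.QuantumFieldTheory.BalabanImbrieJaffe1984to88.BIJ88WalkBlockActivity312
import Literature.MathematicalPhysics.QuantumFieldTheory.BalabanImbrieJaffe1984to88.BIJ88Resummation312

/-!
# `BalabanImbrieJaffe1984to88.BIJ88WalkBlockNorm312` — T. Bałaban, J. Imbrie, A. Jaffe, *Effective action and cluster
properties of the abelian Higgs model*, Commun. Math. Phys. **114** (1988) 257–315 [BalabanImbrieJaffe1988], §5.14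
p. 312 [PDF 56], verbatim: *"The main source of concern in estimating G_k(X_{r′}) is that we only have bounds
|F_{k,loc}(X_{σ₁})| ≤ c(L^kε)^{−m(c)}e^{−m′(c)} coming from our estimates on perturbation expansions of observables
similarly for F_{k+1,loc}(X_c)."*, *"By performing sufficiently many integrations by parts, we have arranged for enough
small factors to beat these large factors in the remainder terms (at least if X_{r′} is not at the boundary of
Λ^{(k)})."*, *"These considerations lead to the following estimate:
|G_k(X)| ≤ c(F(X))(e^β(L^kε/ε₀)^{1/4−α})^{β′|X∖∪X_c|} Π [c(L^kε)^{−m(c)}e^{−m′(c)}]"* (DOCFIX p25 gen 19, ref-5 D-g64-2: the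
gen-18 header paraphrased the second sentence inside quotation marks; the printed sentence is restored, declarations
untouched) — **THE CONSTANT-COMPONENT
ACTIVITIES ARE SUMMABLE AGAINST EXPONENTIAL GROWTH IN THE UNCOVERED CUBES** (p25 gen 18): every constant outcome of
the run of `(i, B)` is bounded by `(Π_j B_ℓ^{|obs j|})·θ^{#(cubes ∖ obs cubes)}` times its counting weight
(`const_outcome_abs_le`, the pointwise form of `BIJ88WalkBlockActivity312.flAbsAt_le`), so that, giving half of the
small factors away, `Σ_X flAbsAt i B X · (√θ)^{−#(X ∖ obs cubes)} ≤ W^Φ · Π_{j∈{i}∪B} B_ℓ^{|obs j|}` over any family of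
cube sets (`sum_flAbsAt_weighted_le`) — the form in which activities enter a convergent cluster expansion
(a Kotecký–Preiss-type norm), uniformly in the number of pieces and of vertices.

statement-level skeleton of published theorems with citation tags; proofs where landed; nothing here is a claim
about the Yang–Mills mass gap

PDF held: `paper:balaban1988-cmp114-bij-abelian-higgs-effective-action` (journal page = PDF page + 256); p. 312 =
PDF 56 (`p0056.txt` L1–25 re-read 2026-08-22; L20–28 re-read for the docfix, 2026-08-23).

CITATION HEADER (lean-in-tree rule).  lit-balaban cell (HOME `run/shared/lean/pub/lit-balaban/`), Phase 2, seat p25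
gen 18; row **C2.Claim@312** of `HOME/lit-balaban-r16/ROWS-C2-part2.md` (owner r16, referee ref-5; head
`BIJ88Sect5StatementsPart4.Ineq312` untouched — MEMBER of the row).  USED BY NAME, nothing restated:
`BIJ88WalkBlockActivity312.flAbsAt`, `BIJ88WalkLocalCount312.run_lsum_pristine_le`, `BIJ88WalkActivityShape312.{shape,
wt_le_shape}`, `BIJ88WalkWeights312.{wt, tsize, run_weight, run_tidy, tidy_pristine, LabDisj}`,
`BIJ88WalkRunEnv311.{run_const, run_pcs_eq, run_lab}`, `BIJ88WalkGeometry311.{cubes, Nondeg}`, `BIJ88WalkRun311`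
(this seat and generation), `BIJ88Resummation312.sum_map_finset_sum_comm` (p25 gen 17), `BIJ88VertexComponents311.maxArity`.

## What is proved (0 `sorry`, standard axioms, no new `Prop` facts; theorems only)

* §1 **`const_outcome_abs_le`**: for every outcome `o` of the run of the pristine `i` in `B` ending constant with
  `rest = ∅`: `o.g.lab = {i} ∪ B` and `|a_o| ≤ (Π_{j∈{i}∪B} B_ℓ^{|obs j|})·θ^{#(cubes o.g ∖ obs cubes)}·[o nondegenerate]·Π_{p∈o.dp} ρ p`.
* §2 **`sum_flAbsAt_weighted_le`**: `Σ_{X ∈ 𝒳} flAbsAt i B X·((√θ)^{#(X ∖ obs cubes)})⁻¹ ≤ W^Φ·Π_{j∈{i}∪B} B_ℓ^{|obs j|}`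
  for every finite family `𝒳` of cube sets.
HONEST SCOPE: (a) constant components only; (b) locality/convergence of the walk expansion and the split `B = B′·ρ`
are HYPOTHESES in abstract form; (c) constant `W^Φ`; (d) contraction-graph components; (e) no `Ineq312` binder.
NOT summit progress; NOT continuum; NOT Clay.  Imports `BIJ88WalkBlockActivity312`, `BIJ88Resummation312`; modifies
nothing.
-/

noncomputable section

namespace Literature.MathematicalPhysics.QuantumFieldTheory.BalabanImbrieJaffe1984to88.BIJ88WalkBlockNorm312

open Classical Matrix Finset
open scoped BigOperators
open BIJ88VertexComponents311 (maxArity)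
open BIJ88Resummation312 (sum_map_finset_sum_comm)
open BIJ88WalkRun311 BIJ88WalkRunEnv311 BIJ88WalkGeometry311 BIJ88WalkWeights312 BIJ88WalkActivityShape312
  BIJ88WalkLocalCount312 BIJ88WalkBlockActivity312

variable {S : Type} [Fintype S] {ι : Type} [Fintype ι] {κ : Type} [LinearOrder κ] {P : Type} [Fintype P]
  {β : Type} [DecidableEq β]

variable {Cov : P → Matrix S S ℝ} {trig : P → Bool} {f : S → ℝ} {c : ι → ℝ} {legs : ι → List (S → ℝ)}
  {obs : κ → List (S → ℝ)} {M : ℕ} {oc : κ → Finset β} {vc : ι → Finset β} {reg : P → Finset β}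

/-! ## §1  Every constant outcome, pointwise -/

/-- **EVERY CONSTANT OUTCOME IN THE PRINTED CURRENCY, POINTWISE**: under the bracket bounds `B′·ρ` (activity part
`B′ ≤ B_ℓ`, no region, on local pieces, `≤ θ^{#reg p}` on walk pieces; `ρ ≥ 0`), couplings `|c m| ≤ cV m` with
`cV m·B_ℓ^{|legs m|} ≤ θ^{#vc m}`, directions in `Dir`, `i ∉ B`: every outcome `o` of the run of the pristine `i` in `B`
that ends constant having absorbed `B` has labels `{i} ∪ B` and
`|a_o| ≤ (Π_{j∈{i}∪B} B_ℓ^{|obs j|}) · θ^{#(cubes o.g ∖ ⋃_{j} oc j)} · ([o nondegenerate]·Π_{p∈o.dp} ρ p)`.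
[cite: BalabanImbrieJaffe1988, §5.14 p.312] -/
theorem const_outcome_abs_le {Dir : Set (S → ℝ)} {B' ρ : P → ℝ} {cV : ι → ℝ} {Bl θ : ℝ}
    (hθ0 : 0 < θ) (hθ1 : θ ≤ 1) (hBl : 1 ≤ Bl) (hB0 : ∀ p, 0 ≤ B' p) (hρ : ∀ p, 0 ≤ ρ p) (hcV0 : ∀ m, 0 ≤ cV m)
    (hB : ∀ p, ∀ u ∈ Dir, ∀ w ∈ Dir, |(Cov p *ᵥ u) ⬝ᵥ w| ≤ B' p * ρ p)
    (hBf : ∀ p, ∀ u ∈ Dir, |(Cov p *ᵥ u) ⬝ᵥ f| ≤ B' p * ρ p) (hBz : ∀ p, ∀ u ∈ Dir, ‖Cov p *ᵥ u‖ ≤ B' p * ρ p)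
    (hcV : ∀ m, |c m| ≤ cV m) (hobs : ∀ j, ∀ w ∈ obs j, w ∈ Dir) (hlegs : ∀ m, ∀ w ∈ legs m, w ∈ Dir)
    (hloc : ∀ p, trig p = false → B' p ≤ Bl ∧ reg p = ∅) (hwalk : ∀ p, trig p = true → B' p ≤ θ ^ (reg p).card)
    (hvert : ∀ m, cV m * Bl ^ (legs m).length ≤ θ ^ (vc m).card) {i : κ} {B : Finset κ} (hi : i ∉ B) :
    ∀ o ∈ run Cov trig f c legs obs M (pristine obs i) B 0, o.g.IsConst M → o.rest = ∅ →
      o.g.lab = insert i B ∧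
        |o.a| ≤ (∏ j ∈ insert i B, Bl ^ (obs j).length) * θ ^ (cubes oc vc reg o.g \ (insert i B).biUnion oc).card
          * (if Nondeg o then (o.dp.map ρ).prod else 0) := by
  intro o ho hconst hrest
  have hBρ0 : ∀ p, 0 ≤ B' p * ρ p := fun p => mul_nonneg (hB0 p) (hρ p)
  have hprod0 : 0 ≤ (o.dp.map ρ).prod :=
    Multiset.prod_nonneg fun x hx => by obtain ⟨p, -, rfl⟩ := Multiset.mem_map.1 hx; exact hρ p
  have hd0 : ∀ h ∈ (0 : Multiset (WGrp S κ ι P)), ∀ w ∈ h.pend, w ∈ Dir := fun h hh => absurd hh (Multiset.notMem_zero _)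
  have hLD : LabDisj (pristine (ι := ι) (P := P) obs i) B 0 :=
    ⟨Finset.disjoint_singleton_left.2 hi, fun h hh => absurd hh (Multiset.notMem_zero _),
      fun h hh => absurd hh (Multiset.notMem_zero _)⟩
  obtain ⟨hD, hdone, -⟩ := run_const _ _ _ o ho (fun h hh => absurd hh (Multiset.notMem_zero _)) hconst
  have hlab : o.g.lab = insert i B := by
    have h := run_lab _ _ _ o ho
    rw [hdone, hrest] at h
    simp only [pristine, Multiset.map_zero, Multiset.sup_zero, Finset.bot_eq_empty, Finset.union_empty] at h
    rw [h, Finset.insert_eq]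
  refine ⟨hlab, ?_⟩
  by_cases hnd : Nondeg o
  swap
  · have ha : o.a = 0 := by
      by_contra ha
      exact hnd ⟨ha, fun z hz => by rw [hD] at hz; exact absurd hz List.not_mem_nil⟩
    rw [if_neg hnd, ha, abs_zero, mul_zero]
  rw [if_pos hnd]
  have hwt1 : wt (fun p => B' p * ρ p) cV (pristine (ι := ι) (P := P) obs i) = 1 := by simp [wt, pristine]
  have hw := run_weight (Cov := Cov) (trig := trig) (f := f) (c := c) (legs := legs) (obs := obs) (M := M)
    (B := fun p => B' p * ρ p) hBρ0 hcV0 hB hBf hBz hcV hobs hlegs (pristine obs i) B 0 o ho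
    (fun w hw => hobs i w hw) hd0
  simp only [hwt1, hdone, Multiset.map_zero, Multiset.prod_zero, mul_one] at hw
  have hts : tsize o = |o.a| := by simp [tsize, hD]
  have hsplit : wt (fun p => B' p * ρ p) cV o.g = wt B' cV o.g * (o.g.pcs.map ρ).prod := by
    simp only [wt, Multiset.prod_map_mul]; ring
  have hpcs : o.g.pcs = o.dp := by simpa [hdone, pristine] using run_pcs_eq _ _ _ o ho
  have hT : Tidy obs legs o.g := (run_tidy _ _ _ o ho hLD (tidy_pristine i) fun h hh =>
    absurd hh (Multiset.notMem_zero _)).1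
  have hle : wt B' cV o.g ≤ shape obs oc vc reg Bl θ o.g := wt_le_shape hθ0 hθ1 hBl hB0 hcV0 hloc hwalk hvert o.g hT
  have hshape : shape obs oc vc reg Bl θ o.g
      = (∏ j ∈ insert i B, Bl ^ (obs j).length) * θ ^ (cubes oc vc reg o.g \ (insert i B).biUnion oc).card := by
    rw [shape, hlab]
  calc |o.a| = tsize o := hts.symm
    _ ≤ wt (fun p => B' p * ρ p) cV o.g := hw
    _ = wt B' cV o.g * (o.dp.map ρ).prod := by rw [hsplit, hpcs]
    _ ≤ _ := mul_le_mul_of_nonneg_right (hle.trans_eq hshape) hprod0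

/-! ## §2  Summability against exponential growth in the uncovered cubes -/

/-- **THE CONSTANT-COMPONENT ACTIVITIES SUMMED AGAINST `(√θ)^{−#(X ∖ obs cubes)}`**: under the hypotheses of
`BIJ88WalkBlockActivity312.flAbsAt_le` (locality `Σ_{p : C_p u ≠ 0} ρ p ≤ ρ₀`, `≤ N₀` coupled vertex legs, `W ≥ 1`,
`ρ₀·(Φ + N₀) ≤ W`), for every finite family `𝒳` of cube sets:
`Σ_{X ∈ 𝒳} flAbsAt i B X · ((√θ)^{#(X ∖ ⋃_{j∈{i}∪B} oc j)})⁻¹ ≤ W^Φ · Π_{j∈{i}∪B} B_ℓ^{|obs j|}` — half of the small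
factor per uncovered cube is given away to sum over the supports. [cite: BalabanImbrieJaffe1988, §5.14 p.312] -/
theorem sum_flAbsAt_weighted_le {Dir : Set (S → ℝ)} {B' ρ : P → ℝ} {cV : ι → ℝ} {Bl θ ρ₀ W : ℝ} {N₀ : ℕ}
    (hθ0 : 0 < θ) (hθ1 : θ ≤ 1) (hBl : 1 ≤ Bl) (hB0 : ∀ p, 0 ≤ B' p) (hρ : ∀ p, 0 ≤ ρ p) (hcV0 : ∀ m, 0 ≤ cV m)
    (hB : ∀ p, ∀ u ∈ Dir, ∀ w ∈ Dir, |(Cov p *ᵥ u) ⬝ᵥ w| ≤ B' p * ρ p)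
    (hBf : ∀ p, ∀ u ∈ Dir, |(Cov p *ᵥ u) ⬝ᵥ f| ≤ B' p * ρ p) (hBz : ∀ p, ∀ u ∈ Dir, ‖Cov p *ᵥ u‖ ≤ B' p * ρ p)
    (hcV : ∀ m, |c m| ≤ cV m) (hobs : ∀ j, ∀ w ∈ obs j, w ∈ Dir) (hlegs : ∀ m, ∀ w ∈ legs m, w ∈ Dir)
    (hloc : ∀ p, trig p = false → B' p ≤ Bl ∧ reg p = ∅) (hwalk : ∀ p, trig p = true → B' p ≤ θ ^ (reg p).card)
    (hvert : ∀ m, cV m * Bl ^ (legs m).length ≤ θ ^ (vc m).card)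
    (hρ₀ : ∀ u ∈ Dir, (∑ p ∈ univ.filter (fun p => Cov p *ᵥ u ≠ 0), ρ p) ≤ ρ₀)
    (hN : ∀ p, ∀ u ∈ Dir,
      (∑ m, ((range (legs m).length).filter fun j => (Cov p *ᵥ u) ⬝ᵥ (legs m).getD j 0 ≠ 0).card) ≤ N₀)
    {i : κ} {B : Finset κ} (hi : i ∉ B) (hW1 : 1 ≤ W)
    (hW : ρ₀ * (((obs i).length + 1 + M * maxArity legs + ∑ j ∈ B, (obs j).length + N₀ : ℕ) : ℝ) ≤ W)
    (𝒳 : Finset (Finset β)) :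
    ∑ X ∈ 𝒳, flAbsAt Cov trig f c legs obs M oc vc reg i B X * (Real.sqrt θ ^ (X \ (insert i B).biUnion oc).card)⁻¹
      ≤ W ^ ((obs i).length + 1 + M * maxArity legs + ∑ j ∈ B, (obs j).length)
        * ∏ j ∈ insert i B, Bl ^ (obs j).length := by
  have hs0 : 0 < Real.sqrt θ := Real.sqrt_pos.2 hθ0
  have hs1 : Real.sqrt θ ≤ 1 := Real.sqrt_le_one.2 hθ1
  have hsq : ∀ n : ℕ, θ ^ n = Real.sqrt θ ^ n * Real.sqrt θ ^ n := fun n => by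
    rw [← mul_pow, Real.mul_self_sqrt hθ0.le]
  have hC0 : 0 ≤ ∏ j ∈ insert i B, Bl ^ (obs j).length := prod_nonneg fun j _ => pow_nonneg (zero_le_one.trans hBl) _
  have hprod0 : ∀ o : WOut S κ ι P, 0 ≤ (if Nondeg o then (o.dp.map ρ).prod else 0) := fun o => by
    split_ifs
    · exact Multiset.prod_nonneg fun x hx => by obtain ⟨p, -, rfl⟩ := Multiset.mem_map.1 hx; exact hρ p
    · exact le_rfl
  -- pointwise in the outcome: at most one cube set is hit, and there half the small factor pays the weight
  have hpt : ∀ o ∈ run Cov trig f c legs obs M (pristine obs i) B 0,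
      ∑ X ∈ 𝒳, (if o.g.IsConst M ∧ o.rest = ∅ ∧ cubes oc vc reg o.g = X then |o.a| else 0)
          * (Real.sqrt θ ^ (X \ (insert i B).biUnion oc).card)⁻¹
        ≤ (∏ j ∈ insert i B, Bl ^ (obs j).length) * (if Nondeg o then (o.dp.map ρ).prod else 0) := by
    intro o ho
    by_cases hcl : o.g.IsConst M ∧ o.rest = ∅
    swap
    · refine le_of_eq_of_le (Finset.sum_eq_zero fun X _ => ?_) (mul_nonneg hC0 (hprod0 o))
      rw [if_neg fun h => hcl ⟨h.1, h.2.1⟩, zero_mul]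
    obtain ⟨-, hbd⟩ := const_outcome_abs_le (oc := oc) hθ0 hθ1 hBl hB0 hρ hcV0 hB hBf hBz hcV hobs hlegs hloc hwalk
      hvert hi o ho hcl.1 hcl.2
    have hone : ∀ X ∈ 𝒳, (if o.g.IsConst M ∧ o.rest = ∅ ∧ cubes oc vc reg o.g = X then |o.a| else 0)
          * (Real.sqrt θ ^ (X \ (insert i B).biUnion oc).card)⁻¹
        = if cubes oc vc reg o.g = X then |o.a| * (Real.sqrt θ ^ (X \ (insert i B).biUnion oc).card)⁻¹ else 0 := by
      intro X _
      by_cases hX : cubes oc vc reg o.g = X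
      · rw [if_pos ⟨hcl.1, hcl.2, hX⟩, if_pos hX]
      · rw [if_neg fun h => hX h.2.2, if_neg hX, zero_mul]
    rw [Finset.sum_congr rfl hone, Finset.sum_ite_eq]
    by_cases hmem : cubes oc vc reg o.g ∈ 𝒳
    · rw [if_pos hmem, mul_inv_le_iff₀ (pow_pos hs0 _)]
      refine hbd.trans ?_
      calc (∏ j ∈ insert i B, Bl ^ (obs j).length) * θ ^ (cubes oc vc reg o.g \ (insert i B).biUnion oc).card
              * (if Nondeg o then (o.dp.map ρ).prod else 0)
          = (∏ j ∈ insert i B, Bl ^ (obs j).length) * (if Nondeg o then (o.dp.map ρ).prod else 0)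
              * Real.sqrt θ ^ (cubes oc vc reg o.g \ (insert i B).biUnion oc).card
              * Real.sqrt θ ^ (cubes oc vc reg o.g \ (insert i B).biUnion oc).card := by rw [hsq]; ring
        _ ≤ (∏ j ∈ insert i B, Bl ^ (obs j).length) * (if Nondeg o then (o.dp.map ρ).prod else 0)
              * Real.sqrt θ ^ (cubes oc vc reg o.g \ (insert i B).biUnion oc).card :=
            mul_le_of_le_one_right (mul_nonneg (mul_nonneg hC0 (hprod0 o)) (pow_nonneg hs0.le _))
              (pow_le_one₀ hs0.le hs1)
    · rw [if_neg hmem]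
      exact mul_nonneg hC0 (hprod0 o)
  calc ∑ X ∈ 𝒳, flAbsAt Cov trig f c legs obs M oc vc reg i B X * (Real.sqrt θ ^ (X \ (insert i B).biUnion oc).card)⁻¹
      = ∑ X ∈ 𝒳, ((run Cov trig f c legs obs M (pristine obs i) B 0).map fun o =>
          (if o.g.IsConst M ∧ o.rest = ∅ ∧ cubes oc vc reg o.g = X then |o.a| else 0)
            * (Real.sqrt θ ^ (X \ (insert i B).biUnion oc).card)⁻¹).sum := by
        refine Finset.sum_congr rfl fun X _ => ?_
        rw [flAbsAt, Multiset.sum_map_mul_right]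
    _ = ((run Cov trig f c legs obs M (pristine obs i) B 0).map fun o => ∑ X ∈ 𝒳,
          (if o.g.IsConst M ∧ o.rest = ∅ ∧ cubes oc vc reg o.g = X then |o.a| else 0)
            * (Real.sqrt θ ^ (X \ (insert i B).biUnion oc).card)⁻¹).sum := (sum_map_finset_sum_comm _ _ _).symm
    _ ≤ ((run Cov trig f c legs obs M (pristine obs i) B 0).map fun o =>
          (∏ j ∈ insert i B, Bl ^ (obs j).length) * (if Nondeg o then (o.dp.map ρ).prod else 0)).sum :=
        Multiset.sum_map_le_sum_map _ _ hpt
    _ = (∏ j ∈ insert i B, Bl ^ (obs j).length) * ((run Cov trig f c legs obs M (pristine obs i) B 0).map fun o =>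
          if Nondeg o then (o.dp.map ρ).prod else 0).sum := by rw [Multiset.sum_map_mul_left]
    _ ≤ (∏ j ∈ insert i B, Bl ^ (obs j).length)
          * W ^ ((obs i).length + 1 + M * maxArity legs + ∑ j ∈ B, (obs j).length) :=
        mul_le_mul_of_nonneg_left (run_lsum_pristine_le (trig := trig) (f := f) (c := c)
          hobs hlegs hρ hρ₀ hN i B hW1 hW) hC0
    _ = _ := mul_comm _ _

end Literature.MathematicalPhysics.QuantumFieldTheory.BalabanImbrieJaffe1984to88.BIJ88WalkBlockNorm312

end
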